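import Mathlib
import HarnessLib

/-!
# Discs about a point containing a zero, from the power sums of the reciprocal shifted zeros

Topic: Algebra / Polynomial (`Literature/Algebra/Polynomial/`); companion of `NearestZeroBounds`
(Henrici §6.4.II: Thm 6.4e, Cor 6.4f/g, Thm 6.4i).

[Henrici1974, §6.4.II, (6.4-10)–(6.4-11), Thm 6.4h]. Let `p` split with zeros `w₁,…,wₙ`
(`n = deg p ≥ 1`) and let `z₀` be a point. Henrici's power sums are
`s_k(z₀) = −Σ_m (w_m − z₀)^{−k}` (`k = 1, 2, …`); they are the Taylor coefficients of the
logarithmic derivative, `p'(z₀ + h)/p(z₀ + h) = Σ_k s_k h^{k−1}`, hence computable from the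
Taylor coefficients `b_m = p^{(m)}(z₀)/m!` by the recurrence (6.4-11)
`s_k = (k b_k − b_{k−1} s₁ − ⋯ − b₁ s_{k−1})/b₀`. If `ρ` is the distance from `z₀` to the nearest
zero then `|s_k| ≤ n ρ^{−k}`, i.e.

**Theorem 6.4h.** *At least one zero of `p` lies in each of the discs
`|z − z₀| ≤ (n/|s_k|)^{1/k}`, `k = 1, 2, …`.*

For `k = 1`, `s₁ = b₁/b₀` gives Cor 6.4g (`NearestZeroBounds`); for `k = 2`,
`s₂ = (2 b₀ b₂ − b₁²)/b₀²`, the disc `|z − z₀| ≤ √n |b₀| / |b₁² − 2 b₀ b₂|^{1/2}`.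

This file proves, over a normed field and for a split polynomial (over `ℂ` unconditionally):

* `recipPowerSum p z₀ k = Σ_{w ∈ roots p} ((w − z₀)^k)⁻¹` (definition; `= −s_k(z₀)`, same modulus);
* `norm_recipPowerSum_le` — `ρ ≤ |w − z₀|` for all zeros, `ρ > 0` ⟹ `‖Σ‖ ≤ n/ρ^k`;
* `exists_root_norm_pow_le` — THM 6.4h: `Σ ≠ 0` ⟹ a zero with `‖w − z₀‖^k ≤ n/‖Σ‖`, and the
  `k`-th-root form `exists_root_norm_le_rpow`;
* `recipPowerSum_one` — `Σ (w − z₀)⁻¹ = −p'(z₀)/p(z₀)`;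
* `hasDerivAt_sum_inv_sub`, `recipPowerSum_two` — the SECOND identity
  `Σ ((w − z₀)²)⁻¹ = (p'(z₀)² − p(z₀) p''(z₀))/p(z₀)²` (the derivative of the logarithmic
  derivative, over a nontrivially normed field);
* `exists_root_norm_sq_le` / `exists_root_norm_le_sqrt` — THM 6.4h for `k = 2` in terms of
  `p(z₀), p'(z₀), p''(z₀)`: a zero with `‖w − z₀‖² ≤ n ‖p(z₀)‖² / ‖p'(z₀)² − p(z₀)p''(z₀)‖`;
* `exists_root_norm_le_sqrt_complex` — the same over `ℂ` without the splitting hypothesis.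

Not formalised: the recurrence (6.4-11) for general `k` (formal power series bookkeeping) and
the identities for `k ≥ 3`; the limit statement `|s_k|^{−1/k} → ρ`.
-/

noncomputable section

open Polynomial

namespace Literature.Algebra.Polynomial.NearestZeroPowerSums

variable {𝕜 : Type*}

section NormedField

variable [NormedField 𝕜] {p : 𝕜[X]}

/-- The power sum of the reciprocal shifted zeros, `Σ_{w ∈ roots p} ((w − z₀)^k)⁻¹`
(Henrici's `s_k(z₀)` is its negative). [cite: Henrici1974, §6.4 (6.4-10)] -/
def recipPowerSum (p : 𝕜[X]) (z₀ : 𝕜) (k : ℕ) : 𝕜 :=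
  (p.roots.map fun w => ((w - z₀) ^ k)⁻¹).sum

/-- Unfolding of `recipPowerSum`: the sum of reciprocal `m`-th powers of the zeros (with multiplicity)
shifted by `z₀`. [folklore] -/
private theorem recipPowerSum_def (p : 𝕜[X]) (z₀ : 𝕜) (k : ℕ) :
    recipPowerSum p z₀ k = (p.roots.map fun w => ((w - z₀) ^ k)⁻¹).sum := rfl

/-- If every zero satisfies `ρ ≤ |w − z₀|` (`ρ > 0`) then `‖Σ ((w − z₀)^k)⁻¹‖ ≤ n/ρ^k`
(`n = deg p`, `p` split). [cite: Henrici1974, §6.4.II] -/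
theorem norm_recipPowerSum_le (hsplit : p.Splits) {z₀ : 𝕜} (k : ℕ) {ρ : ℝ} (hρ : 0 < ρ)
    (h : ∀ w ∈ p.roots, ρ ≤ ‖w - z₀‖) :
    ‖recipPowerSum p z₀ k‖ ≤ p.natDegree / ρ ^ k := by
  rw [recipPowerSum, hsplit.natDegree_eq_card_roots]
  refine (norm_multiset_sum_le _).trans ?_
  rw [Multiset.map_map]
  have hle : ∀ x ∈ p.roots.map ((fun u => ‖u‖) ∘ fun w => ((w - z₀) ^ k)⁻¹), x ≤ (ρ ^ k)⁻¹ := by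
    intro x hx
    obtain ⟨w, hw, rfl⟩ := Multiset.mem_map.mp hx
    simp only [Function.comp_apply, norm_inv, norm_pow]
    exact inv_anti₀ (pow_pos hρ k) (pow_le_pow_left₀ hρ.le (h w hw) k)
  have := Multiset.sum_le_card_nsmul _ _ hle
  rw [Multiset.card_map, nsmul_eq_mul] at this
  rw [div_eq_mul_inv]
  exact this

/-- **Theorem 6.4h** (abstract form). If `p` splits and `Σ_{w} ((w − z₀)^k)⁻¹ ≠ 0`, then some
zero satisfies `‖w − z₀‖^k ≤ n / ‖Σ ((w − z₀)^k)⁻¹‖`. [cite: Henrici1974, §6.4 Thm 6.4h] -/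
theorem exists_root_norm_pow_le (hsplit : p.Splits) {z₀ : 𝕜} {k : ℕ}
    (hs : recipPowerSum p z₀ k ≠ 0) :
    ∃ w ∈ p.roots, ‖w - z₀‖ ^ k ≤ p.natDegree / ‖recipPowerSum p z₀ k‖ := by
  have hne : p.roots ≠ 0 := by
    intro h; rw [recipPowerSum, h, Multiset.map_zero, Multiset.sum_zero] at hs; exact hs rfl
  have hn : 0 < p.natDegree := by
    rw [hsplit.natDegree_eq_card_roots]; exact Multiset.card_pos.mpr hne
  have hsn : 0 < ‖recipPowerSum p z₀ k‖ := norm_pos_iff.mpr hs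
  by_contra hcon
  push Not at hcon
  -- every term is smaller than `‖Σ‖ / n`
  have hlt : ∀ w ∈ p.roots, ‖((w - z₀) ^ k)⁻¹‖ < ‖recipPowerSum p z₀ k‖ / p.natDegree := by
    intro w hw
    have h1 := hcon w hw
    have hpos : 0 < (p.natDegree : ℝ) / ‖recipPowerSum p z₀ k‖ := div_pos (by exact_mod_cast hn) hsn
    rw [norm_inv, norm_pow, ← inv_div]
    exact inv_strictAnti₀ hpos h1
  have hsum := Multiset.sum_lt_sum_of_nonempty hne hlt
  simp only [Multiset.map_const', Multiset.sum_replicate, nsmul_eq_mul] at hsum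
  rw [← hsplit.natDegree_eq_card_roots, mul_div_cancel₀ _ (by exact_mod_cast hn.ne')] at hsum
  have := (norm_multiset_sum_le (p.roots.map fun w => ((w - z₀) ^ k)⁻¹))
  rw [Multiset.map_map, Function.comp_def] at this
  exact absurd (this.trans_lt hsum) (lt_irrefl _)

/-- **Theorem 6.4h** (`k`-th-root form). If `p` splits, `k ≥ 1` and `Σ ((w − z₀)^k)⁻¹ ≠ 0`, then
some zero lies in the disc `‖w − z₀‖ ≤ (n / ‖Σ ((w − z₀)^k)⁻¹‖)^{1/k}`.
[cite: Henrici1974, §6.4 Thm 6.4h] -/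
theorem exists_root_norm_le_rpow (hsplit : p.Splits) {z₀ : 𝕜} {k : ℕ} (hk : k ≠ 0)
    (hs : recipPowerSum p z₀ k ≠ 0) :
    ∃ w ∈ p.roots, ‖w - z₀‖ ≤ (p.natDegree / ‖recipPowerSum p z₀ k‖) ^ (k⁻¹ : ℝ) := by
  obtain ⟨w, hw, hle⟩ := exists_root_norm_pow_le hsplit hs
  refine ⟨w, hw, ?_⟩
  rw [← Real.pow_rpow_inv_natCast (norm_nonneg (w - z₀)) hk]
  exact Real.rpow_le_rpow (pow_nonneg (norm_nonneg _) k) hle (by positivity)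

/-- `k = 1`: `Σ (w − z₀)⁻¹ = −p'(z₀)/p(z₀)` for `p(z₀) ≠ 0` — Henrici's `s₁ = b₁/b₀`.
[cite: Henrici1974, §6.4 (6.4-11)] -/
theorem recipPowerSum_one (hsplit : p.Splits) {z₀ : 𝕜} (h0 : p.eval z₀ ≠ 0) :
    recipPowerSum p z₀ 1 = -(p.derivative.eval z₀ / p.eval z₀) := by
  rw [recipPowerSum, hsplit.eval_derivative_div_eval_of_ne_zero h0, ← Multiset.sum_map_neg]
  exact congrArg _ (Multiset.map_congr rfl fun w _ => by rw [pow_one, one_div, ← inv_neg, neg_sub])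

end NormedField

section NontriviallyNormedField

variable [NontriviallyNormedField 𝕜] {p : 𝕜[X]}

/-- The derivative of `z ↦ Σ_{w ∈ s} (z − w)⁻¹` at a point off `s` is `−Σ ((z − w)²)⁻¹`.
[folklore] -/
private theorem hasDerivAt_sum_inv_sub (s : Multiset 𝕜) {z : 𝕜} (hz : ∀ w ∈ s, z - w ≠ 0) :
    HasDerivAt (fun x => (s.map fun w => (x - w)⁻¹).sum)
      (-(s.map fun w => ((z - w) ^ 2)⁻¹).sum) z := by
  induction s using Multiset.induction_on with
  | empty => simpa using hasDerivAt_const z (0 : 𝕜)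
  | cons a s ih =>
    have ha : z - a ≠ 0 := hz a (Multiset.mem_cons_self a s)
    have h1 : HasDerivAt (fun x => (x - a)⁻¹) (-((z - a) ^ 2)⁻¹) z := by
      have := (hasDerivAt_inv ha).comp z ((hasDerivAt_id z).sub_const a)
      simpa [Function.comp_def] using this
    have h2 := h1.add (ih fun w hw => hz w (Multiset.mem_cons_of_mem hw))
    simp only [Multiset.map_cons, Multiset.sum_cons, neg_add]
    exact h2

/-- `k = 2`: **the derivative of the logarithmic derivative.** For `p` split and `p(z₀) ≠ 0`,
`Σ_{w} ((w − z₀)²)⁻¹ = (p'(z₀)² − p(z₀) p''(z₀)) / p(z₀)²` — Henrici's `s₂ = (2b₀b₂ − b₁²)/b₀²`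
with `b₀ = p(z₀)`, `b₁ = p'(z₀)`, `b₂ = p''(z₀)/2`. [cite: Henrici1974, §6.4 (6.4-11)] -/
theorem recipPowerSum_two (hsplit : p.Splits) {z₀ : 𝕜} (h0 : p.eval z₀ ≠ 0) :
    recipPowerSum p z₀ 2 =
      (p.derivative.eval z₀ ^ 2 - p.eval z₀ * p.derivative.derivative.eval z₀) /
        p.eval z₀ ^ 2 := by
  -- no zero coincides with `z₀`
  have hz : ∀ w ∈ p.roots, z₀ - w ≠ 0 := by
    intro w hw h
    rw [sub_eq_zero] at h
    rw [h] at h0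
    exact h0 ((mem_roots'.mp hw).2)
  -- the logarithmic derivative agrees with the root sum near `z₀`
  have hev : ∀ᶠ x in nhds z₀, p.eval x ≠ 0 := (p.continuous.continuousAt).eventually_ne h0
  have heq : (fun x => p.derivative.eval x / p.eval x) =ᶠ[nhds z₀]
      fun x => (p.roots.map fun w => (x - w)⁻¹).sum := by
    filter_upwards [hev] with x hx
    rw [hsplit.eval_derivative_div_eval_of_ne_zero hx]
    exact congrArg _ (Multiset.map_congr rfl fun w _ => one_div _)
  have hD1 : HasDerivAt (fun x => p.derivative.eval x / p.eval x)
      (-(p.roots.map fun w => ((z₀ - w) ^ 2)⁻¹).sum) z₀ :=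
    (hasDerivAt_sum_inv_sub p.roots hz).congr_of_eventuallyEq heq
  have hD2 : HasDerivAt (fun x => p.derivative.eval x / p.eval x)
      ((p.derivative.derivative.eval z₀ * p.eval z₀ -
        p.derivative.eval z₀ * p.derivative.eval z₀) / p.eval z₀ ^ 2) z₀ :=
    (p.derivative.hasDerivAt z₀).div (p.hasDerivAt z₀) h0
  have huniq := hD1.unique hD2
  -- `(w − z₀)² = (z₀ − w)²`
  have hsym : recipPowerSum p z₀ 2 = (p.roots.map fun w => ((z₀ - w) ^ 2)⁻¹).sum := by
    rw [recipPowerSum]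
    exact congrArg _ (Multiset.map_congr rfl fun w _ => by rw [sub_sq_comm])
  rw [hsym, ← neg_neg (Multiset.sum _), huniq]
  field_simp
  ring

/-- **Theorem 6.4h for `k = 2`.** If `p` splits, `p(z₀) ≠ 0` and `p'(z₀)² ≠ p(z₀) p''(z₀)`, then
some zero satisfies `‖w − z₀‖² ≤ n ‖p(z₀)‖² / ‖p'(z₀)² − p(z₀) p''(z₀)‖`.
[cite: Henrici1974, §6.4 Thm 6.4h] -/
theorem exists_root_norm_sq_le (hsplit : p.Splits) {z₀ : 𝕜} (h0 : p.eval z₀ ≠ 0)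
    (hD : p.derivative.eval z₀ ^ 2 - p.eval z₀ * p.derivative.derivative.eval z₀ ≠ 0) :
    ∃ w ∈ p.roots, ‖w - z₀‖ ^ 2 ≤ p.natDegree * ‖p.eval z₀‖ ^ 2 /
      ‖p.derivative.eval z₀ ^ 2 - p.eval z₀ * p.derivative.derivative.eval z₀‖ := by
  have hs : recipPowerSum p z₀ 2 ≠ 0 := by
    rw [recipPowerSum_two hsplit h0]
    exact div_ne_zero hD (pow_ne_zero 2 h0)
  obtain ⟨w, hw, hle⟩ := exists_root_norm_pow_le hsplit hs
  refine ⟨w, hw, ?_⟩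
  rw [recipPowerSum_two hsplit h0, norm_div, norm_pow, div_div_eq_mul_div] at hle
  exact hle

/-- **Theorem 6.4h for `k = 2`, radius form:** a zero in the disc
`‖w − z₀‖ ≤ √n ‖p(z₀)‖ / √‖p'(z₀)² − p(z₀)p''(z₀)‖`. [cite: Henrici1974, §6.4 Thm 6.4h] -/
theorem exists_root_norm_le_sqrt (hsplit : p.Splits) {z₀ : 𝕜} (h0 : p.eval z₀ ≠ 0)
    (hD : p.derivative.eval z₀ ^ 2 - p.eval z₀ * p.derivative.derivative.eval z₀ ≠ 0) :
    ∃ w ∈ p.roots, ‖w - z₀‖ ≤ Real.sqrt p.natDegree * ‖p.eval z₀‖ /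
      Real.sqrt ‖p.derivative.eval z₀ ^ 2 - p.eval z₀ * p.derivative.derivative.eval z₀‖ := by
  obtain ⟨w, hw, hle⟩ := exists_root_norm_sq_le hsplit h0 hD
  refine ⟨w, hw, ?_⟩
  have hDpos : 0 < ‖p.derivative.eval z₀ ^ 2 - p.eval z₀ * p.derivative.derivative.eval z₀‖ :=
    norm_pos_iff.mpr hD
  rw [← Real.sqrt_le_sqrt_iff (by positivity), Real.sqrt_sq (norm_nonneg _)] at hle
  · refine hle.trans (le_of_eq ?_)
    rw [Real.sqrt_div (by positivity), Real.sqrt_mul (Nat.cast_nonneg _),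
      Real.sqrt_sq (norm_nonneg _)]

end NontriviallyNormedField

/-- **Theorem 6.4h for `k = 2` over `ℂ`** (no splitting hypothesis): `p(z₀) ≠ 0`,
`p'(z₀)² ≠ p(z₀)p''(z₀)` ⟹ a zero in `‖w − z₀‖ ≤ √n ‖p(z₀)‖ / √‖p'(z₀)² − p(z₀)p''(z₀)‖`.
[cite: Henrici1974, §6.4 Thm 6.4h] -/
theorem exists_root_norm_le_sqrt_complex {p : ℂ[X]} {z₀ : ℂ} (h0 : p.eval z₀ ≠ 0)
    (hD : p.derivative.eval z₀ ^ 2 - p.eval z₀ * p.derivative.derivative.eval z₀ ≠ 0) :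
    ∃ w ∈ p.roots, ‖w - z₀‖ ≤ Real.sqrt p.natDegree * ‖p.eval z₀‖ /
      Real.sqrt ‖p.derivative.eval z₀ ^ 2 - p.eval z₀ * p.derivative.derivative.eval z₀‖ :=
  exists_root_norm_le_sqrt (IsAlgClosed.splits p) h0 hD

end Literature.Algebra.Polynomial.NearestZeroPowerSums

end
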